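import Mathlib
import Literature.NumberTheory.LFunctions.Zhang2022.NumericsSection15AppB
import HarnessLib

/-!
# Zhang (2022), Appendix B, proof of (B.3): the value the proof arrives at, and the (B.3) bookkeeping

Topic `Literature/NumberTheory/LFunctions/Zhang2022` (Landau–Siegel audit tree; verdict-neutral).
Y. Zhang, *Discrete mean estimates and the Landau–Siegel zero*, arXiv:2211.02515v1 (2022)
[Zhang2022LandauSiegel] — **an unrefereed manuscript under adjudication**. Appendix B, proof of (B.3)
(p. 108, tex L5316–5334), typed nodes of `Zhang2022.TypedAppendixB` (namespace `…Typed.AppendixB`):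
`tailB3` (the left side of (B.3)), `doubleB15` (the double integral of the last display, first line),
`valueB15` (its second line, "`(1/0.504)(β_j/β₆)∫_{0.5}^{0.504}(P^{β₆(0.504−z)} − P^{0.004β₆})dz`"),
`StepB_u015aR/bR/cR`, `EqB_3R` (the `α₁ = α log T` reading of record). This file PROVES:

* `valueB15_eq` — for `D ≥ 3` and `j ∈ {1,2,3}`, EXACTLY `valueB15 c′ D j = (1 + κ_jc′α𝓛)·e″_{1j}(derived)`
  with `κ₁ = −5, κ₂ = 1, κ₃ = −1` (`e″_{1j}(derived)` = the tree's `AppendixB.e1ppD j = −jπi·b*`;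
  `β_j/β₆ = (2j/3)(1 + κ_jc′α𝓛)` by (2.13), (2.22), and `P^{β₆w} = e^{(3/2)wπi}` since `α log P = π`;
  the case `j = 1` is the cell's `Numerics.valueB15_one_eq`);
* `valueB15_sub_e1ppD_le` — hence "`… = e″_{1j} + O(α₁)`" HOLDS with the DERIVED constant:
  `‖valueB15 c′ D j − e1ppD j‖ ≤ 5|c′|·α𝓛` (the closing "□" of the proof of (B.3) in the derived
  reading; with the STATED `e″_{1j}` = `Section18Defs.e1ppj` it fails for every `c′`, the cell's
  `Numerics.not_StepB_u015c`, since `e1ppD 1 ≠ e1ppj 1`);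
* the bookkeeping of the last two displays: `tailB3_sub_e1ppD_of` — `StepB_u015aR → StepB_u015bR →`
  "`Σ_{l>P^{1/2}/l₁} ϰ₁(l₁l)ϱ_j(l)/l = e″_{1j}(derived) + O(α₁)`"; and `eqB_3R_of` —
  `StepB_u015aR → StepB_u015bR → StepB_u015cR → EqB_3R` (the printed chain to (B.3) as typed).

DAG nodes (cell siegel-zhang): `Z22:§B.u015` (second line / "□"), `Z22:(B.3)`. No claim about Lemma 15.1,
Theorems 1–2 of the source or about Landau–Siegel zeros is made.
-/

noncomputable section

open Complex Real Finset

namespace Literature.NumberTheory.LFunctions.Zhang2022.AppendixBVarrho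

open Literature.NumberTheory.LFunctions.Zhang2022 Skeleton Typed.AppendixB

/-! ## The value of the last display -/

/-- **`valueB15 c′ D j = (1 + κ_jc′α𝓛)·e″_{1j}(derived)`** for `D ≥ 3`, `j ∈ {1,2,3}`, with
`κ₁ = −5`, `κ₂ = 1`, `κ₃ = −1` (`β₁/β₆ = (2/3)(1−5c′α𝓛)`, `β₂/β₆ = (4/3)(1+c′α𝓛)`, `β₃/β₆ = 2(1−c′α𝓛)`).
[cite: Zhang2022LandauSiegel, App. B (B.3) p.108, (2.13), (2.22)] -/
theorem valueB15_eq (c' : ℝ) {D : ℕ} (hD : 3 ≤ D) {j : ℕ} (hj : j ∈ ({1, 2, 3} : Finset ℕ)) :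
    ∃ κ : ℝ, |κ| ≤ 5 ∧
      valueB15 c' D j = ((1 + κ * c' * alpha D * ell D : ℝ) : ℂ) * e1ppD j := by
  have hα : Skeleton.alpha D ≠ 0 := (Numerics.alpha_pos' hD).ne'
  have hαC : (Skeleton.alpha D : ℂ) ≠ 0 := by exact_mod_cast hα
  have hI : (I : ℂ) ≠ 0 := Complex.I_ne_zero
  rw [Typed.AppendixB.valueB15, Numerics.valueB15_integral_eq hD, e1ppD]
  set J : ℂ := ∫ z in (0.5:ℝ)..0.504, (cexp (3 / 2 * (0.504 - z) * π * I) - cexp (3 / 2 * 0.004 * π * I))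
    with hJ
  simp only [Finset.mem_insert, Finset.mem_singleton] at hj
  rcases hj with rfl | rfl | rfl
  · refine ⟨-5, by norm_num, ?_⟩
    have hβ : betaJ c' D 1 = beta1 c' D := by simp [betaJ]
    rw [hβ, beta1, beta6]
    push_cast
    field_simp
    ring
  · refine ⟨1, by norm_num, ?_⟩
    have hβ : betaJ c' D 2 = beta2 c' D := by simp [betaJ]
    rw [hβ, beta2, beta6]
    push_cast
    field_simp
  · refine ⟨-1, by norm_num, ?_⟩
    have hβ : betaJ c' D 3 = beta3 c' D := by simp [betaJ]
    rw [hβ, beta3, beta6]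
    push_cast
    field_simp
    ring

/-- `‖e″_{1j}(derived)‖ ≤ 1` for `j ≤ 3` (crude: `(1/0.504)(2j/3)·2·0.004`). [cite: Zhang2022LandauSiegel, App. B (B.3) p.108] -/
theorem norm_e1ppD_le_one {j : ℕ} (hj : j ∈ ({1, 2, 3} : Finset ℕ)) : ‖e1ppD j‖ ≤ 1 := by
  have hj3 : (j : ℝ) ≤ 3 := by
    simp only [Finset.mem_insert, Finset.mem_singleton] at hj
    rcases hj with rfl | rfl | rfl <;> norm_num
  have hint : ‖∫ z in (0.5:ℝ)..0.504, (cexp (3 / 2 * (0.504 - z) * π * I) - cexp (3 / 2 * 0.004 * π * I))‖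
      ≤ 2 * |0.504 - 0.5| := by
    refine intervalIntegral.norm_integral_le_of_norm_le_const fun z _ => ?_
    calc ‖cexp (3 / 2 * (0.504 - z) * π * I) - cexp (3 / 2 * 0.004 * π * I)‖
        ≤ ‖cexp (3 / 2 * (0.504 - z) * π * I)‖ + ‖cexp (3 / 2 * 0.004 * π * I)‖ := norm_sub_le _ _
      _ = 2 := by
          rw [show (3 / 2 * (0.504 - (z : ℂ)) * π * I) = ((3 / 2 * (0.504 - z) * π : ℝ) : ℂ) * I by
              push_cast; ring,
            show (3 / 2 * 0.004 * (π : ℂ) * I) = ((3 / 2 * 0.004 * π : ℝ) : ℂ) * I by push_cast; ring,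
            Complex.norm_exp_ofReal_mul_I, Complex.norm_exp_ofReal_mul_I]
          norm_num
  rw [e1ppD, norm_mul, norm_mul]
  have h1 : ‖(((1 / 0.504 : ℝ)) : ℂ)‖ = 1 / 0.504 := by
    rw [Complex.norm_real, Real.norm_eq_abs, abs_of_pos (by norm_num)]
  have h2 : ‖(2 * (j : ℂ) / 3)‖ = 2 * j / 3 := by
    rw [norm_div, norm_mul, Complex.norm_natCast]; norm_num
  rw [h1, h2]
  have h3 : |(0.504 : ℝ) - 0.5| = 0.004 := by norm_num
  rw [h3] at hint
  calc 1 / 0.504 * (2 * (j : ℝ) / 3) *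
        ‖∫ z in (0.5:ℝ)..0.504, (cexp (3 / 2 * (0.504 - z) * π * I) - cexp (3 / 2 * 0.004 * π * I))‖
      ≤ 1 / 0.504 * (2 * 3 / 3) * (2 * 0.004) := by gcongr
    _ ≤ 1 := by norm_num

/-- **The "□" of the proof of (B.3) in the DERIVED reading**: for `D ≥ 3` and `j ∈ {1,2,3}`,
`‖valueB15 c′ D j − e″_{1j}(derived)‖ ≤ 5|c′|·α𝓛` (in particular `O(α₁)` in either reading of `α₁`).
[cite: Zhang2022LandauSiegel, App. B (B.3) p.108] -/
theorem valueB15_sub_e1ppD_le (c' : ℝ) {D : ℕ} (hD : 3 ≤ D) {j : ℕ} (hj : j ∈ ({1, 2, 3} : Finset ℕ)) :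
    ‖valueB15 c' D j - e1ppD j‖ ≤ 5 * |c'| * alpha D * ell D := by
  obtain ⟨κ, hκ, hv⟩ := valueB15_eq c' hD hj
  have hαℓ : 0 ≤ alpha D * ell D := Numerics.alpha_mul_ell_nonneg D
  rw [hv]
  have : ((1 + κ * c' * alpha D * ell D : ℝ) : ℂ) * e1ppD j - e1ppD j =
      ((κ * c' * alpha D * ell D : ℝ) : ℂ) * e1ppD j := by push_cast; ring
  rw [this, norm_mul, Complex.norm_real, Real.norm_eq_abs]
  calc |κ * c' * alpha D * ell D| * ‖e1ppD j‖ ≤ |κ * c' * alpha D * ell D| * 1 :=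
        mul_le_mul_of_nonneg_left (norm_e1ppD_le_one hj) (abs_nonneg _)
    _ = |κ| * |c'| * (alpha D * ell D) := by
        rw [mul_one, show κ * c' * alpha D * ell D = κ * c' * (alpha D * ell D) by ring, abs_mul, abs_mul,
          abs_of_nonneg hαℓ]
    _ ≤ 5 * |c'| * (alpha D * ell D) := by gcongr
    _ = 5 * |c'| * alpha D * ell D := by ring

/-- The derived-reading "□" as an eventual statement (shape of `StepB_u015c`, with `e1ppD` for `e1ppj`):
`‖valueB15 c′ D j − e1ppD j‖ ≤ 5|c′|·α𝓛` for all `D ≥ 3`, `j ∈ {1,2,3}`.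
[cite: Zhang2022LandauSiegel, App. B (B.3) p.108] -/
theorem stepB_u015cD (c' : ℝ) : ForAllLarge fun D _ _ => ∀ j ∈ ({1, 2, 3} : Finset ℕ),
    ‖valueB15 c' D j - e1ppD j‖ ≤ 5 * |c'| * alpha D * ell D :=
  ⟨3, fun _ _ _ hD _ _ _ hj => valueB15_sub_e1ppD_le c' hD hj⟩

/-! ## Bookkeeping of the last two displays of the proof of (B.3) -/

/-- **The (B.3) tail in the derived reading**: from `StepB_u015aR` (tail `≈ doubleB15`) and
`StepB_u015bR` (`doubleB15 ≈ valueB15`): "`Σ_{l > P^{1/2}/l₁} ϰ₁(l₁l)ϱ_j(l)/l = e″_{1j}(derived) + O(α₁)`"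
(`α₁ = Skeleton.alpha1`; `α𝓛 ≤ α₁`, `Skeleton.alpha_mul_ell_le_alpha1`).
[cite: Zhang2022LandauSiegel, App. B (B.3) p.108] -/
theorem tailB3_sub_e1ppD_of (c' : ℝ) (ha : StepB_u015aR c') (hb : StepB_u015bR c') :
    ∃ C : ℝ, ForAllLarge fun D _ _ =>
      ∀ j ∈ ({1, 2, 3} : Finset ℕ), ∀ l₁ : ℕ, 1 ≤ l₁ → l₁ ∈ nset (frakq D) → (l₁ : ℝ) < bigT D →
        ‖tailB3 c' D j l₁ - e1ppD j‖ ≤ C * alpha1 D := by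
  obtain ⟨Ca, ha⟩ := ha
  obtain ⟨Cb, hb⟩ := hb
  obtain ⟨D₀, h⟩ := ha.and hb
  refine ⟨Ca + Cb + 5 * |c'|, max D₀ 3, fun D _ χ hD hq hp j hj l₁ hl₁ hn hT => ?_⟩
  obtain ⟨e₁, e₂⟩ := h D χ (le_trans (le_max_left _ _) hD) hq hp
  have hD3 : 3 ≤ D := le_trans (le_max_right _ _) hD
  have h1 := e₁ j hj l₁ hl₁ hn hT
  have h2 := e₂ j hj l₁ hl₁ hn hT
  have h3 := valueB15_sub_e1ppD_le c' hD3 hj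
  have h4 : alpha D * ell D ≤ alpha1 D := alpha_mul_ell_le_alpha1 hD3
  have hα1 : 0 ≤ alpha1 D := le_trans (Numerics.alpha_mul_ell_nonneg D) h4
  calc ‖tailB3 c' D j l₁ - e1ppD j‖
      = ‖(tailB3 c' D j l₁ - doubleB15 c' D j l₁) + (doubleB15 c' D j l₁ - valueB15 c' D j) +
          (valueB15 c' D j - e1ppD j)‖ := by congr 1; ring
    _ ≤ ‖tailB3 c' D j l₁ - doubleB15 c' D j l₁‖ + ‖doubleB15 c' D j l₁ - valueB15 c' D j‖ +
          ‖valueB15 c' D j - e1ppD j‖ := norm_add₃_le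
    _ ≤ Ca * alpha1 D + Cb * alpha1 D + 5 * |c'| * alpha D * ell D := by gcongr
    _ ≤ Ca * alpha1 D + Cb * alpha1 D + 5 * |c'| * alpha1 D := by
        have : 5 * |c'| * (alpha D * ell D) ≤ 5 * |c'| * alpha1 D :=
          mul_le_mul_of_nonneg_left h4 (by positivity)
        linarith
    _ = (Ca + Cb + 5 * |c'|) * alpha1 D := by ring

/-- **(B.3) as typed, from its printed chain** (`α₁` reading): `StepB_u015aR → StepB_u015bR → StepB_u015cR
→ EqB_3R` (triangle inequality; recorded for the DAG — `StepB_u015cR` is refuted in the cell, so this edge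
does not make `EqB_3R` a theorem). [cite: Zhang2022LandauSiegel, App. B (B.3) p.108] -/
theorem eqB_3R_of (c' : ℝ) (ha : StepB_u015aR c') (hb : StepB_u015bR c') (hc : StepB_u015cR c') :
    EqB_3R c' := by
  obtain ⟨Ca, ha⟩ := ha
  obtain ⟨Cb, hb⟩ := hb
  obtain ⟨Cc, hc⟩ := hc
  obtain ⟨D₀, h⟩ := (ha.and hb).and hc
  refine ⟨Ca + Cb + Cc, D₀, fun D _ χ hD hq hp j hj l₁ hl₁ hn hT => ?_⟩
  obtain ⟨⟨e₁, e₂⟩, e₃⟩ := h D χ hD hq hp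
  have h1 := e₁ j hj l₁ hl₁ hn hT
  have h2 := e₂ j hj l₁ hl₁ hn hT
  have h3 := e₃ j hj
  calc ‖tailB3 c' D j l₁ - e1ppj j‖
      = ‖(tailB3 c' D j l₁ - doubleB15 c' D j l₁) + (doubleB15 c' D j l₁ - valueB15 c' D j) +
          (valueB15 c' D j - e1ppj j)‖ := by congr 1; ring
    _ ≤ ‖tailB3 c' D j l₁ - doubleB15 c' D j l₁‖ + ‖doubleB15 c' D j l₁ - valueB15 c' D j‖ +
          ‖valueB15 c' D j - e1ppj j‖ := norm_add₃_le
    _ ≤ Ca * alpha1 D + Cb * alpha1 D + Cc * alpha1 D := by gcongr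
    _ = (Ca + Cb + Cc) * alpha1 D := by ring

end Literature.NumberTheory.LFunctions.Zhang2022.AppendixBVarrho
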